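import Mathlib
import HarnessLib

/-!
# Markman 2023 (JEMS, REFEREED) — PROPOSITION 11.2, formula (11.1): the Chern-class arithmetic of its proof
# AS PRINTED (pp. 291–293), kernel-checked in the degree-≤4 truncation of `ℚ[c₁(𝒫), π₁^*[pt_X], π₂^*[pt_X̂]]`

E. Markman: [K] *The monodromy of generalized Kummer varieties and algebraic cycles on their intermediate Jacobians*,
J. Eur. Math. Soc. 25 (2023), 231–321, bib `Markman2023GeneralizedKummers` — REFEREED; JEMS numbering and PRINTED
page numbers (EMS PDF sha256/16 `aad67923b9fd46bc`, PDF page = printed page − 230), displays read BY EYE at seat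
lit-w-markman (pub-hsemireg LIT-W, 2026-08-23; renders `r_jems_p291.png`–`r_jems_p293.png`). (The held arXiv text
1805.11574 is pre-v4 and numbers items differently — ERRATUM #3 of the cell; only JEMS numbers are used here.)

## What is printed (verbatim)

* SETTING (p. 291): «We will need to treat first the case `w = s_n := (1, 0, −n)`. Let `𝒫` be the Poincaré line bundle
  over `X × X̂`, normalized so that its restriction to `{0} × X̂` is trivial. Denote by `[pt_X] ∈ H⁴(X, ℤ)` the class
  Poincaré dual to a point and define `[pt_X̂] ∈ H⁴(X̂, ℤ)` similarly. Let `π_i` be the projection from `X × X̂` onto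
  the `i`-th factor, `i = 1, 2`.»  (`X` an abelian SURFACE, `𝓜(s_n) ≅ X^{[n]} × X̂`, `E_F` the restriction of the
  modular sheaf (1.6) = `ℰxt¹_{pr₂}(L pr₁^*F, 𝒰)`, of rank `m − 2` for `m = dim 𝓜(w)` (Theorem 11.1 (2), p. 291; here
  `m = dim(X^{[n]} × X̂) = 2n + 2`, p. 292 L1, so the rank is `2n`), `ι_F : X × X̂ → 𝓜(w)` the orbit map; p. 291.)
* PROPOSITION 11.2 (p. 291): «If `w = s_n`, then `ι_F^*(c₂(ℰnd(E_F))) = −n²c₁(𝒫)² + 4n³π₁^*[pt_X] + 4nπ₂^*[pt_X̂]`,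
  (11.1) and the above class is `Spin(S⁺_X)_{s_n}`-invariant.»
* PROOF, the class (p. 292, last display): «We conclude that
  `[Φ_{ι_F^*𝒰}(F^∨)] = −n[𝒪_{X×X̂}] + π₂^![ℂ_0̂] − n[𝒫] + n²π₁^![ℂ₀]`.»  (from «`[Φ_{p₁₃^*𝒫}(F^∨)] = −n[𝒪_{X×X̂}] +
  π₂^![ℂ_0̂]`», «`[Φ_{δ_*𝒫}(F^∨)] = [𝒫] − nπ₁^![ℂ₀]`» and «the class `[ι_F^*𝒰]` of `ι_F^*𝒰` in the topological
  `K`-group of `X × X × X̂` is equal to `[p₁₃^*𝒫] − n[δ_*𝒫]`», same page.)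
* PROOF, the arithmetic (p. 293 L1–13, by eye): «The first three terms of its Chern character are thus
  `−ch[Φ_{ι_F^*𝒰}(F^∨)] = 2n + nc₁(𝒫) + (n/2)c₁(𝒫)² − n²π₁^*[pt_X] − π₂^*[pt_X̂] + ⋯`.
  Given a class `α` in the topological `K`-group, of non-zero rank `r`, set `κ(α) := ch(α) exp(−c₁(α)/r)`. So the
  graded summand of degree `4` of the class `κ(−[Φ_{ι_F^*𝒰}(F^∨)]) := ch[−Φ_{ι_F^*𝒰}(F^∨)](1 − (1/2)c₁(𝒫) +
  (1/8)c₁(𝒫)² + ⋯)` is `κ₂(−[Φ_{ι_F^*𝒰}(F^∨)]) = (n/4)c₁(𝒫)² − n²π₁^*[pt_X] − π₂^*[pt_X̂]`. If we set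
  `b := [−Φ_{ι_F^*𝒰}(F^∨)]`, then `c₂(b ⊗ b^*) = −ch₂(b ⊗ b^*) = −4nκ₂(b)`, which is equal to the right hand side of
  (11.1). Finally, `ℋ^i(Φ_𝒰(F^∨))` vanishes if `i ∉ {1, 2}`, and `ℋ²(Φ_𝒰(F^∨))` is supported on the point of `𝓜(w)`
  representing `F`, and so on a subvariety of codimension `≥ 4`. Hence, `c_i(E_F) = c_i(ℋ¹(Φ_𝒰(F^∨))) =
  c_i(−Φ_𝒰(F^∨))` for `i = 1, 2`, and so `ι_F^*c₂(ℰnd(E_F)) = ⋯ = c₂([Φ_{ι_F^*𝒰}(F^∨)] ⊗ [Φ_{ι_F^*𝒰}(F^∨)]^*)`,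
  where the last equality follows from cohomology and base change … Equality (11.1) thus follows.»

## The model (standard; every input is BY VALUE) and what this file proves (NO named fact; nothing geometric)
Only degrees `0, 2, 4` of `H^{2•}(X × X̂, ℚ)` enter `c₂`. `H4Trunc K` below is the degree-`≤ 4` truncation of the
commutative graded algebra generated by `c := c₁(𝒫)` (degree 2) and `p₁ := π₁^*[pt_X]`, `p₂ := π₂^*[pt_X̂]`
(degree 4): coordinates `(a₀; a₁; a_{cc}, a_{p1}, a_{p2}) ↔ a₀ + a₁c + a_{cc}c² + a_{p1}p₁ + a_{p2}p₂`, products of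
total degree `> 4` dropped (nothing about `X` is formalised; that `c², p₁, p₂` are linearly independent in
`H⁴(X × X̂, ℚ)` is not needed for the identities and not claimed). Inputs by value: `ch(𝒪) = 1`, `ch(𝒫) = exp(c₁(𝒫))`
(degrees `≤ 4`: `1 + c + c²/2`), `ch(π₁^![ℂ₀]) = π₁^*[pt_X]`, `ch(π₂^![ℂ_0̂]) = π₂^*[pt_X̂]` (GRR with `td = 1` on
abelian varieties), `ch_i(b^*) = (−1)^i ch_i(b)`, `c₂ = −ch₂` for a class with `c₁ = 0`, and the printed `K`-class
itself. PROVED (ring arithmetic only): the displayed «first three terms» of `−ch[Φ_{ι_F^*𝒰}(F^∨)]`; `ch₀(b) = 2n`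
(= rank `E_F = m − 2`, `m = dim 𝓜(s_n) = dim(X^{[n]} × X̂) = 2n + 2`, p. 292 L1), `c₁(b) = nc₁(𝒫)`; the truncated
`exp(−c₁(b)/2n) = 1 − c/2 + c²/8` as displayed; `κ₂(b) = (n/4)c₁(𝒫)² − n²π₁^*[pt_X] − π₂^*[pt_X̂]`; `ch₂(b ⊗ b^*) = 2·ch₀(b)ch₂(b) − ch₁(b)²`,
`c₁(b ⊗ b^*) = 0`, and `c₂(b ⊗ b^*) = −ch₂(b ⊗ b^*) = −4nκ₂(b) = −n²c₁(𝒫)² + 4n³π₁^*[pt_X] + 4nπ₂^*[pt_X̂]` — the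
right hand side of (11.1). The `Spin(S⁺_X)_{s_n}`-invariance half of Proposition 11.2, Theorem 11.1, cohomology and
base change, and the vanishing of `ℋ^i` are NOT formalised. Bookkeeping for the pub-hsemireg LIT-W table row M-Mk8
(record note (iv): (11.1) «a reproducible for a sheaf engine on `X × X̂`, `X` an abelian surface»); it says nothing
about hyperholomorphic sheaves, semiregularity or the Hodge conjecture and re-proves no theorem of [K].
-/

namespace Literature.AlgebraicGeometry.HodgeTheory.ModularSheafCayley

/-- Degree-`≤ 4` classes `a₀ + a₁·c₁(𝒫) + a_{cc}·c₁(𝒫)² + a_{p1}·π₁^*[pt_X] + a_{p2}·π₂^*[pt_X̂]` in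
`H^{2•}(X × X̂, K)`, `X` an abelian surface, with the product truncated above degree `4` (the model of the module
docstring; inputs by value). [cite: Markman2023GeneralizedKummers, proof of Proposition 11.2, pp. 292–293] -/
@[ext] structure H4Trunc (K : Type*) where
  /-- degree 0 -/
  a0 : K
  /-- coefficient of `c₁(𝒫)` (degree 2) -/
  a1 : K
  /-- coefficient of `c₁(𝒫)²` (degree 4) -/
  acc : K
  /-- coefficient of `π₁^*[pt_X]` (degree 4) -/
  ap1 : K
  /-- coefficient of `π₂^*[pt_X̂]` (degree 4) -/
  ap2 : K

namespace H4Trunc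

variable {K : Type*} [Field K]

/-- zero class -/
@[simps] instance : Zero (H4Trunc K) := ⟨⟨0, 0, 0, 0, 0⟩⟩
/-- `1 ∈ H⁰` -/
@[simps] instance : One (H4Trunc K) := ⟨⟨1, 0, 0, 0, 0⟩⟩
/-- sum -/
@[simps] instance : Add (H4Trunc K) :=
  ⟨fun x y => ⟨x.a0 + y.a0, x.a1 + y.a1, x.acc + y.acc, x.ap1 + y.ap1, x.ap2 + y.ap2⟩⟩
/-- negative -/
@[simps] instance : Neg (H4Trunc K) := ⟨fun x => ⟨-x.a0, -x.a1, -x.acc, -x.ap1, -x.ap2⟩⟩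
/-- difference -/
@[simps] instance : Sub (H4Trunc K) :=
  ⟨fun x y => ⟨x.a0 - y.a0, x.a1 - y.a1, x.acc - y.acc, x.ap1 - y.ap1, x.ap2 - y.ap2⟩⟩
/-- scalars -/
@[simps] instance : SMul K (H4Trunc K) := ⟨fun a x => ⟨a * x.a0, a * x.a1, a * x.acc, a * x.ap1, a * x.ap2⟩⟩
/-- cup product truncated above degree `4`: `c·c = c²`; every other product of two positive-degree generators has
degree `> 4` and is dropped. -/
@[simps] instance : Mul (H4Trunc K) := ⟨fun x y => ⟨x.a0 * y.a0, x.a0 * y.a1 + x.a1 * y.a0,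
    x.a0 * y.acc + x.a1 * y.a1 + x.acc * y.a0, x.a0 * y.ap1 + x.ap1 * y.a0, x.a0 * y.ap2 + x.ap2 * y.a0⟩⟩

/-- `c := c₁(𝒫)`. [cite: Markman2023GeneralizedKummers, Proposition 11.2, p. 291] -/
@[simps] def c : H4Trunc K := ⟨0, 1, 0, 0, 0⟩
/-- `p₁ := π₁^*[pt_X]`. [cite: Markman2023GeneralizedKummers, Proposition 11.2, p. 291] -/
@[simps] def p1 : H4Trunc K := ⟨0, 0, 0, 1, 0⟩
/-- `p₂ := π₂^*[pt_X̂]`. [cite: Markman2023GeneralizedKummers, Proposition 11.2, p. 291] -/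
@[simps] def p2 : H4Trunc K := ⟨0, 0, 0, 0, 1⟩
/-- `exp(a·c₁(𝒫))` truncated above degree `4`: `1 + a c + (a²/2) c²` (`= ch(𝒫^{⊗a})` in these degrees; by value).
[cite: Markman2023GeneralizedKummers, proof of Proposition 11.2, p. 293 (the factor `1 − (1/2)c₁(𝒫) + (1/8)c₁(𝒫)²`)] -/
@[simps] def expc (a : K) : H4Trunc K := ⟨1, a, a ^ 2 / 2, 0, 0⟩
/-- the sign `(−1)^i` on degree `2i`: `ch(b^*) = dual (ch b)`. [folklore] -/
@[simps] def dual (x : H4Trunc K) : H4Trunc K := ⟨x.a0, -x.a1, x.acc, x.ap1, x.ap2⟩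
/-- the degree-4 part `(a_{cc}, a_{p1}, a_{p2})` as a class. [folklore] -/
@[simps] def deg4 (x : H4Trunc K) : H4Trunc K := ⟨0, 0, x.acc, x.ap1, x.ap2⟩

/-- INPUT BY VALUE, [K] p. 292 last display «`[Φ_{ι_F^*𝒰}(F^∨)] = −n[𝒪_{X×X̂}] + π₂^![ℂ_0̂] − n[𝒫] + n²π₁^![ℂ₀]`»,
read through `ch` (`ch 𝒪 = 1`, `ch 𝒫 = exp(c₁(𝒫))`, `ch(π₁^!ℂ₀) = π₁^*[pt_X]`, `ch(π₂^!ℂ_0̂) = π₂^*[pt_X̂]` — GRR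
with `td = 1`, by value), degrees `≤ 4`. [cite: Markman2023GeneralizedKummers, proof of Proposition 11.2, p. 292] -/
def chPhi (n : K) : H4Trunc K := -(n • (1 : H4Trunc K)) + p2 - n • expc 1 + (n ^ 2) • p1

/-- `b := [−Φ_{ι_F^*𝒰}(F^∨)]` read through `ch`: `ch(b) = −ch[Φ_{ι_F^*𝒰}(F^∨)]`.
[cite: Markman2023GeneralizedKummers, proof of Proposition 11.2, p. 293] -/
def chb (n : K) : H4Trunc K := -chPhi n

variable [CharZero K]

/-- Model sanity: `c·c = c²`, `c·c² = c·p_i = p_i·p_j = 0` (degree `> 4` dropped), `exp` multiplicative in the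
truncation. [folklore] -/
private theorem model_sanity (a a' : K) :
    (c : H4Trunc K) * c = ⟨0, 0, 1, 0, 0⟩ ∧ (c : H4Trunc K) * (c * c) = 0 ∧ (c : H4Trunc K) * p1 = 0 ∧
    (p1 : H4Trunc K) * p2 = 0 ∧ expc a * expc a' = (expc (a + a') : H4Trunc K) := by
  refine ⟨?_, ?_, ?_, ?_, ?_⟩ <;> ext <;> simp <;> ring

/-- **[K] p. 293 L1–2** «The first three terms of its Chern character are thus
`−ch[Φ_{ι_F^*𝒰}(F^∨)] = 2n + nc₁(𝒫) + (n/2)c₁(𝒫)² − n²π₁^*[pt_X] − π₂^*[pt_X̂] + ⋯`»: in the model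
`ch(b) = 2n + n c + (n/2) c² − n² p₁ − p₂`; in particular `ch₀(b) = 2n` (the rank of `E_F = ℋ¹`, `= m − 2` with
`m = dim 𝓜(s_n) = dim(X^{[n]} × X̂) = 2n + 2`) and `c₁(b) = n c₁(𝒫)`.
[cite: Markman2023GeneralizedKummers, proof of Proposition 11.2, p. 293 L1–2] -/
theorem chb_eq (n : K) :
    chb n = (2 * n) • (1 : H4Trunc K) + n • c + (n / 2) • (c * c) - (n ^ 2) • p1 - p2 ∧
    (chb n).a0 = 2 * n ∧ (chb n).a1 = n := by
  refine ⟨?_, ?_, ?_⟩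
  · ext <;> simp [chb, chPhi] <;> ring
  · simp [chb, chPhi]; ring
  · simp [chb, chPhi]

/-- **[K] p. 293 L3–8** «Given a class `α` in the topological `K`-group, of non-zero rank `r`, set
`κ(α) := ch(α) exp(−c₁(α)/r)`. So the graded summand of degree `4` of the class
`κ(−[Φ(F^∨)]) := ch[−Φ(F^∨)](1 − (1/2)c₁(𝒫) + (1/8)c₁(𝒫)² + ⋯)` is
`κ₂(−[Φ(F^∨)]) = (n/4)c₁(𝒫)² − n²π₁^*[pt_X] − π₂^*[pt_X̂]`»: with `r = 2n ≠ 0` and `c₁(b) = nc₁(𝒫)`,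
`exp(−c₁(b)/r) = exp(−c₁(𝒫)/2) = 1 − (1/2)c + (1/8)c²` in degrees `≤ 4`, and the degree-4 part of `ch(b)·exp(−c/2)`
is the displayed class. [cite: Markman2023GeneralizedKummers, proof of Proposition 11.2, p. 293 L3–8] -/
theorem kappa_two (n : K) (hn : n ≠ 0) :
    -((chb n).a1 / (chb n).a0) = -(1 / 2 : K) ∧
    expc (-(1 / 2 : K)) = (⟨1, -(1 / 2), 1 / 8, 0, 0⟩ : H4Trunc K) ∧
    deg4 (chb n * expc (-(1 / 2 : K))) = (n / 4) • (c * c) - (n ^ 2) • p1 - (p2 : H4Trunc K) := by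
  refine ⟨?_, ?_, ?_⟩
  · simp [chb, chPhi]; field_simp; ring
  · ext <;> simp
    all_goals norm_num
  · ext <;> simp [chb, chPhi]
    all_goals ring

/-- **[K] p. 293 L9–10** «If we set `b := [−Φ_{ι_F^*𝒰}(F^∨)]`, then `c₂(b ⊗ b^*) = −ch₂(b ⊗ b^*) = −4nκ₂(b)`, which is
equal to the right hand side of (11.1).»: with `ch(b^*) = dual(ch b)` (sign `(−1)^i` on degree `2i`),
`ch(b ⊗ b^*) = ch(b)·dual(ch b)` has `c₁ = 0` (so `c₂ = −ch₂`, by value) and degree-4 part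
`2·ch₀ch₂ − ch₁²`; the three displayed equalities hold in the model and the common value is
`−n²c₁(𝒫)² + 4n³π₁^*[pt_X] + 4nπ₂^*[pt_X̂]` — formula (11.1) of PROPOSITION 11.2 (p. 291).
[cite: Markman2023GeneralizedKummers, Proposition 11.2 (11.1), p. 291; proof p. 293 L9–10] -/
theorem c2_End_eq_11_1 (n : K) :
    (chb n * dual (chb n)).a1 = 0 ∧
    -deg4 (chb n * dual (chb n)) = -(4 * n) • ((n / 4) • (c * c) - (n ^ 2) • p1 - (p2 : H4Trunc K)) ∧
    -(4 * n) • ((n / 4) • (c * c) - (n ^ 2) • p1 - (p2 : H4Trunc K))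
      = -(n ^ 2) • (c * c) + (4 * n ^ 3) • p1 + (4 * n) • p2 := by
  refine ⟨?_, ?_, ?_⟩
  · simp [chb, chPhi]; ring
  · ext <;> simp [chb, chPhi] <;> ring
  · ext <;> simp <;> ring

/-- The same number two ways (consistency of the printed chain): `−ch₂(b ⊗ b^*) = ch₁(b)² − 2ch₀(b)ch₂(b)` computed
directly from `ch(b) = 2n + nc + (n/2)c² − n²p₁ − p₂` equals (11.1), and equals `−2r·κ₂(b)` with `r = 2n` — the
general identity `c₂(b ⊗ b^*) = −2 rank(b)·κ₂(b)` behind «`= −4nκ₂(b)`».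
[cite: Markman2023GeneralizedKummers, proof of Proposition 11.2, p. 293 L9–10] -/
theorem c2_End_two_routes (n : K) :
    -deg4 (chb n * dual (chb n)) = -(n ^ 2) • (c * c) + (4 * n ^ 3) • p1 + (4 * n) • (p2 : H4Trunc K) ∧
    -deg4 (chb n * dual (chb n)) = -(2 * (2 * n)) • deg4 (chb n * expc (-(1 / 2 : K))) := by
  constructor
  · ext <;> simp [chb, chPhi] <;> ring
  · ext <;> simp [chb, chPhi] <;> ring

end H4Trunc

end Literature.AlgebraicGeometry.HodgeTheory.ModularSheafCayley
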